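import Literature.Analysis.FluidPDE.ElgindiEllipticVeryWeak
import Literature.Analysis.Distribution.DivFormRegularity
import Literature.Analysis.Distribution.EllipticRegularityProofs
import Mathlib.Analysis.SpecialFunctions.Pow.Deriv
import Mathlib.LinearAlgebra.Basis.Fin
import HarnessLib

/-!
# Interior regularity of the weak solution of Elgindi's polar elliptic problem
([Elgindi2021] §7.1, Proposition 7.1: "the unique `L²` solution … standard `L^p` theory")

Topic `Literature/Analysis/FluidPDE`. Support file (definitions with bodies and proved theorems, no
named facts) on the proof path of the named fact
`Literature.Analysis.FluidPDE.Elgindi.ElgindiGhoulMasmoudi2021_stabilityCore`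
(`ElgindiStabilityDecomposition.lean`). T. M. Elgindi, Ann. of Math. 194 (2021) =
arXiv:1904.04795, §7.1 Proposition 7.1 (p. 19 of the held text).

The first component `U₀` of the weak solution satisfies the very weak equation
`∫∫ U₀·ᵗL(Φ) = ∫∫ F·Φ` (`ElgindiEllipticVeryWeak.lean`). Dividing by the positive weight
`w = R^{1−5/α}/cos θ` (`regWeight`) puts the transpose `ᵗL` in divergence form,
`∂_R(wα²R²∂_Rφ) + ∂_θ(w∂_θφ) − w(5α−α²−6)φ = −w·ᵗL(φ)` (`divForm_eq_neg_weight_mul_transposeOp`),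
so `v = U₀/w ∈ L¹_loc(strip)` is a very weak solution of a divergence-form equation with smooth
positive-definite coefficients on the open strip; Folland's Cor. (6.34) in the tree's form
`exists_contDiffOn_ae_eq_of_divForm_weak` (`DivFormRegularity.lean`, with the named fact
discharged by `Folland1995_cor634_holds`) makes `v`, hence `U₀`, locally equal a.e. to a smooth
function (`exists_local_smooth_rep`).
-/

noncomputable section

open MeasureTheory Set Real Filter Function
open _root_.Topology
open scoped ENNReal InnerProductSpace ContDiff

namespace Literature.Analysis.FluidPDE

namespace Elgindi

open Literature.Analysis.Distribution

/-! ### The regularising weight `w = R^{1−5/α}/cos θ` -/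

/-- The weight `w(R,θ) = R^{1−5/α}/cos θ`. [folklore] -/
def regWeight (α : ℝ) (p : ℝ × ℝ) : ℝ := p.1 ^ (1 - 5 / α) / Real.cos p.2

/-- Unfolding `regWeight`. [folklore] -/
theorem regWeight_apply (α : ℝ) (p : ℝ × ℝ) : regWeight α p = p.1 ^ (1 - 5 / α) / Real.cos p.2 := rfl

/-- `cos θ > 0` on the strip. [folklore] -/
theorem cos_pos_of_mem_strip {p : ℝ × ℝ} (hp : p ∈ strip) : 0 < Real.cos p.2 :=
  Real.cos_pos_of_mem_Ioo ⟨by linarith [hp.2.1, Real.pi_pos], hp.2.2⟩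

/-- The weight is positive on the strip. [folklore] -/
theorem regWeight_pos (α : ℝ) {p : ℝ × ℝ} (hp : p ∈ strip) : 0 < regWeight α p :=
  div_pos (Real.rpow_pos_of_pos hp.1 _) (cos_pos_of_mem_strip hp)

/-- The weight is smooth on the strip. [folklore] -/
theorem contDiffOn_regWeight (α : ℝ) {n : WithTop ℕ∞} : ContDiffOn ℝ n (regWeight α) strip := by
  intro p hp
  refine ContDiffAt.contDiffWithinAt ?_
  have h1 : ContDiffAt ℝ n (fun p : ℝ × ℝ => p.1 ^ (1 - 5 / α)) p :=
    (Real.contDiffAt_rpow_const_of_ne (p := 1 - 5 / α) hp.1.ne').comp p contDiffAt_fst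
  have h2 : ContDiffAt ℝ n (fun p : ℝ × ℝ => Real.cos p.2) p := Real.contDiff_cos.contDiffAt.comp p contDiffAt_snd
  exact h1.div h2 (cos_pos_of_mem_strip hp).ne'

/-- The radial slice derivative of the weight: `∂_R w = ((1−5/α)/R)·w`. [folklore] -/
theorem hasDerivAt_regWeight_fst (α : ℝ) {p : ℝ × ℝ} (hp : p ∈ strip) :
    HasDerivAt (fun R => regWeight α (R, p.2)) ((1 - 5 / α) / p.1 * regWeight α p) p.1 := by
  have h := (Real.hasDerivAt_rpow_const (p := 1 - 5 / α) (Or.inl hp.1.ne')).div_const (Real.cos p.2)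
  refine h.congr_deriv ?_
  rw [regWeight_apply, Real.rpow_sub_one hp.1.ne']
  field_simp

/-- The angular slice derivative of the weight: `∂_θ w = tan θ·w`. [folklore] -/
theorem hasDerivAt_regWeight_snd (α : ℝ) {p : ℝ × ℝ} (hp : p ∈ strip) :
    HasDerivAt (fun θ => regWeight α (p.1, θ)) (Real.tan p.2 * regWeight α p) p.2 := by
  have hc : Real.cos p.2 ≠ 0 := (cos_pos_of_mem_strip hp).ne'
  have h := ((Real.hasDerivAt_cos p.2).inv hc).const_mul (p.1 ^ (1 - 5 / α))
  have h' : HasDerivAt (fun θ => regWeight α (p.1, θ)) (p.1 ^ (1 - 5 / α) * (-(-Real.sin p.2) / Real.cos p.2 ^ 2)) p.2 := by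
    refine h.congr_of_eventuallyEq (Eventually.of_forall fun θ => ?_)
    show regWeight α (p.1, θ) = p.1 ^ (1 - 5 / α) * (Real.cos θ)⁻¹
    rw [regWeight_apply, div_eq_mul_inv]
  refine h'.congr_deriv ?_
  rw [regWeight_apply, Real.tan_eq_sin_div_cos]
  field_simp

/-! ### Coordinate derivatives on `ℝ²` as slice derivatives -/

/-- `Dφ(y)(1,0) = ∂_Rφ(y)`. [folklore] -/
theorem fderiv_apply_one_zero {φ : ℝ × ℝ → ℝ} {y : ℝ × ℝ} (h : DifferentiableAt ℝ φ y) :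
    fderiv ℝ φ y (1, 0) = dz (fun R θ => φ (R, θ)) y.1 y.2 := by
  have hc : HasDerivAt (fun R : ℝ => (R, y.2)) (1, 0) y.1 := (hasDerivAt_id y.1).prodMk (hasDerivAt_const y.1 y.2)
  have h2 := h.hasFDerivAt.comp_hasDerivAt y.1 hc
  exact (h2.deriv).symm

/-- `Dφ(y)(0,1) = ∂_θφ(y)`. [folklore] -/
theorem fderiv_apply_zero_one {φ : ℝ × ℝ → ℝ} {y : ℝ × ℝ} (h : DifferentiableAt ℝ φ y) :
    fderiv ℝ φ y (0, 1) = dθ (fun R θ => φ (R, θ)) y.1 y.2 := by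
  have hc : HasDerivAt (fun θ : ℝ => (y.1, θ)) (0, 1) y.2 := (hasDerivAt_const y.2 y.1).prodMk (hasDerivAt_id y.2)
  have h2 := h.hasFDerivAt.comp_hasDerivAt y.2 hc
  exact (h2.deriv).symm

/-! ### The divergence-form coefficients -/

/-- The coefficient matrix `a = diag(wα²R², w)`. [folklore] -/
def divCoeff (α : ℝ) : Fin 2 → Fin 2 → ℝ × ℝ → ℝ
  | 0, 0 => fun p => regWeight α p * (α ^ 2 * p.1 ^ 2)
  | 1, 1 => fun p => regWeight α p
  | 0, 1 => fun _ => 0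
  | 1, 0 => fun _ => 0

/-- The zeroth-order coefficient `c = w(5α − α² − 6)`. [folklore] -/
def divZero (α : ℝ) (p : ℝ × ℝ) : ℝ := regWeight α p * (5 * α - α ^ 2 - 6)

/-- The coefficients are smooth on the strip. [folklore] -/
theorem contDiffOn_divCoeff (α : ℝ) (i j : Fin 2) : ContDiffOn ℝ ∞ (divCoeff α i j) strip := by
  fin_cases i <;> fin_cases j
  · exact (contDiffOn_regWeight α).mul ((contDiff_const.mul (contDiff_fst.pow 2)).contDiffOn)
  · exact contDiffOn_const
  · exact contDiffOn_const
  · exact contDiffOn_regWeight α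

/-- `c` is smooth on the strip. [folklore] -/
theorem contDiffOn_divZero (α : ℝ) : ContDiffOn ℝ ∞ (divZero α) strip := (contDiffOn_regWeight α).mul contDiffOn_const

/-- The coefficient matrix is positive definite on the strip (`α ≠ 0`). [folklore] -/
theorem divCoeff_pos {α : ℝ} (hα : α ≠ 0) {x : ℝ × ℝ} (hx : x ∈ strip) (v : Fin 2 → ℝ) (hv : v ≠ 0) :
    0 < ∑ i, ∑ j, divCoeff α i j x * (v i * v j) := by
  simp only [Fin.sum_univ_two]
  show 0 < regWeight α x * (α ^ 2 * x.1 ^ 2) * (v 0 * v 0) + 0 * (v 0 * v 1) + (0 * (v 1 * v 0) + regWeight α x * (v 1 * v 1))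
  have hw := regWeight_pos α hx
  have hR := hx.1
  have hαR : 0 < α ^ 2 * x.1 ^ 2 := mul_pos (by positivity) (pow_pos hR 2)
  have h0 : v 0 ≠ 0 ∨ v 1 ≠ 0 := by
    by_contra h
    rw [not_or, not_not, not_not] at h
    exact hv (funext fun i => by fin_cases i <;> simp [h.1, h.2])
  have n0 : 0 ≤ v 0 * v 0 := mul_self_nonneg _
  have n1 : 0 ≤ v 1 * v 1 := mul_self_nonneg _
  rcases h0 with h | h
  · have : 0 < v 0 * v 0 := mul_self_pos.2 h
    nlinarith [mul_pos (mul_pos hw hαR) this, mul_nonneg hw.le n1]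
  · have : 0 < v 1 * v 1 := mul_self_pos.2 h
    nlinarith [mul_pos hw this, mul_nonneg (mul_nonneg hw.le hαR.le) n0]

/-! ### The divergence form of the transpose -/

/-- The standard basis of `ℝ²`. [folklore] -/
abbrev stdBasis : Module.Basis (Fin 2) ℝ (ℝ × ℝ) := Module.Basis.finTwoProd ℝ

/-- The divergence-form expression `∑ᵢⱼ ∂ⱼ(aᵢⱼ∂ᵢφ) − cφ` of `DivFormRegularity.lean`, for our
coefficients. [folklore] -/
def divBracket (α : ℝ) (φ : ℝ × ℝ → ℝ) (x : ℝ × ℝ) : ℝ :=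
  (∑ i, ∑ j, fderiv ℝ (fun y => divCoeff α i j y * fderiv ℝ φ y (stdBasis i)) x (stdBasis j)) - divZero α x * φ x

/-- Unfolding `divBracket`. [folklore] -/
theorem divBracket_apply (α : ℝ) (φ : ℝ × ℝ → ℝ) (x : ℝ × ℝ) : divBracket α φ x =
    (∑ i, ∑ j, fderiv ℝ (fun y => divCoeff α i j y * fderiv ℝ φ y (stdBasis i)) x (stdBasis j)) - divZero α x * φ x := rfl

/-- The two sums, expanded. [folklore] -/
theorem divBracket_expand (α : ℝ) (φ : ℝ × ℝ → ℝ) (x : ℝ × ℝ) : divBracket α φ x =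
    fderiv ℝ (fun y => regWeight α y * (α ^ 2 * y.1 ^ 2) * fderiv ℝ φ y (1, 0)) x (1, 0) +
      fderiv ℝ (fun y => regWeight α y * fderiv ℝ φ y (0, 1)) x (0, 1) - divZero α x * φ x := by
  rw [divBracket_apply]
  simp only [Fin.sum_univ_two, stdBasis, Module.Basis.finTwoProd_zero, Module.Basis.finTwoProd_one]
  have e01 : (fun y => divCoeff α 0 1 y * fderiv ℝ φ y (1, 0)) = fun _ => 0 := by funext y; simp [divCoeff]
  have e10 : (fun y => divCoeff α 1 0 y * fderiv ℝ φ y (0, 1)) = fun _ => 0 := by funext y; simp [divCoeff]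
  rw [e01, e10, fderiv_fun_const]
  show fderiv ℝ (fun y => divCoeff α 0 0 y * fderiv ℝ φ y (1, 0)) x (1, 0) + (0 : ℝ) +
      ((0 : ℝ) + fderiv ℝ (fun y => divCoeff α 1 1 y * fderiv ℝ φ y (0, 1)) x (0, 1)) - divZero α x * φ x = _
  rw [add_zero, zero_add]
  rfl

/-- Off the support of `φ` the bracket vanishes. [folklore] -/
theorem divBracket_eq_zero_of_notMem (α : ℝ) {φ : ℝ × ℝ → ℝ} {x : ℝ × ℝ} (hx : x ∉ tsupport φ) : divBracket α φ x = 0 := by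
  rw [divBracket_expand]
  have hopen : IsOpen (tsupport φ)ᶜ := (isClosed_tsupport _).isOpen_compl
  have hφ0 : φ =ᶠ[𝓝 x] fun _ => 0 := by
    filter_upwards [hopen.mem_nhds hx] with y hy using image_eq_zero_of_notMem_tsupport hy
  have hD0 : ∀ᶠ y in 𝓝 x, fderiv ℝ φ y = 0 := by
    have : ∀ᶠ y in 𝓝 x, φ =ᶠ[𝓝 y] fun _ => 0 := by
      filter_upwards [hopen.mem_nhds hx] with y hy
      filter_upwards [hopen.mem_nhds hy] with z hz using image_eq_zero_of_notMem_tsupport hz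
    filter_upwards [this] with y hy
    rw [hy.fderiv_eq]; exact fderiv_const_apply _
  have h1 : (fun y => regWeight α y * (α ^ 2 * y.1 ^ 2) * fderiv ℝ φ y (1, 0)) =ᶠ[𝓝 x] fun _ => 0 := by
    filter_upwards [hD0] with y hy; rw [hy]; simp
  have h2 : (fun y => regWeight α y * fderiv ℝ φ y (0, 1)) =ᶠ[𝓝 x] fun _ => 0 := by
    filter_upwards [hD0] with y hy; rw [hy]; simp
  rw [h1.fderiv_eq, h2.fderiv_eq, hφ0.eq_of_nhds]
  simp

set_option maxHeartbeats 1600000 in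
/-- **The transpose in divergence form**: on the strip,
`∂_R(wα²R²∂_Rφ) + ∂_θ(w∂_θφ) − w(5α−α²−6)φ = −w·ᵗL(φ)`. [folklore] -/
theorem divBracket_eq_neg_weight_mul_transposeOp {α : ℝ} (hα : α ≠ 0) {φ : ℝ × ℝ → ℝ} (hφ : ContDiff ℝ 2 φ)
    {x : ℝ × ℝ} (hx : x ∈ strip) :
    divBracket α φ x = -regWeight α x * transposeOp α (fun R θ => φ (R, θ)) x := by
  rw [divBracket_expand]
  set Φ : ℝ → ℝ → ℝ := fun R θ => φ (R, θ) with hΦ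
  have hΦ2 : ContDiff ℝ 2 (uncurry Φ) := by
    have e : uncurry Φ = φ := by funext p; rfl
    rw [e]; exact hφ
  have hdiff : ∀ y, DifferentiableAt ℝ φ y := fun y => (hφ.differentiable (by norm_num)) y
  -- inner derivatives
  have e1 : (fun y : ℝ × ℝ => regWeight α y * (α ^ 2 * y.1 ^ 2) * fderiv ℝ φ y (1, 0)) =
      fun y => regWeight α y * (α ^ 2 * y.1 ^ 2) * dz Φ y.1 y.2 := by
    funext y; rw [fderiv_apply_one_zero (hdiff y)]
  have e2 : (fun y : ℝ × ℝ => regWeight α y * fderiv ℝ φ y (0, 1)) = fun y => regWeight α y * dθ Φ y.1 y.2 := by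
    funext y; rw [fderiv_apply_zero_one (hdiff y)]
  rw [e1, e2]
  -- differentiability of the products at `x`
  have hw : DifferentiableAt ℝ (regWeight α) x := ((contDiffOn_regWeight α (n := 1)).differentiableOn (by norm_num)).differentiableAt (isOpen_strip.mem_nhds hx)
  have hdzΦ : ContDiff ℝ 1 (uncurry (dz Φ)) := contDiff_dz_of_contDiff (n := 1) hΦ2
  have hdθΦ : ContDiff ℝ 1 (uncurry (dθ Φ)) := contDiff_dθ_of_contDiff (n := 1) hΦ2
  have hdz : DifferentiableAt ℝ (fun y : ℝ × ℝ => dz Φ y.1 y.2) x := (hdzΦ.differentiable (by norm_num)) x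
  have hdθ : DifferentiableAt ℝ (fun y : ℝ × ℝ => dθ Φ y.1 y.2) x := (hdθΦ.differentiable (by norm_num)) x
  have hp1 : DifferentiableAt ℝ (fun y : ℝ × ℝ => regWeight α y * (α ^ 2 * y.1 ^ 2) * dz Φ y.1 y.2) x :=
    (hw.mul (by fun_prop)).mul hdz
  have hp2 : DifferentiableAt ℝ (fun y : ℝ × ℝ => regWeight α y * dθ Φ y.1 y.2) x := hw.mul hdθ
  rw [fderiv_apply_one_zero hp1, fderiv_apply_zero_one hp2]
  -- the slice derivatives of the products
  have sw1 := hasDerivAt_regWeight_fst α hx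
  have sw2 := hasDerivAt_regWeight_snd α hx
  have sdz : HasDerivAt (fun R => dz Φ R x.2) (dz (dz Φ) x.1 x.2) x.1 :=
    (((hdzΦ.comp (contDiff_id.prodMk contDiff_const)).differentiable (by norm_num)) x.1).hasDerivAt
  have sdθ : HasDerivAt (fun θ => dθ Φ x.1 θ) (dθ (dθ Φ) x.1 x.2) x.2 :=
    (((hdθΦ.comp (contDiff_const.prodMk contDiff_id)).differentiable (by norm_num)) x.2).hasDerivAt
  have sR2 : HasDerivAt (fun R : ℝ => α ^ 2 * R ^ 2) (α ^ 2 * (2 * x.1)) x.1 := by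
    simpa using ((hasDerivAt_pow 2 x.1).const_mul (α ^ 2))
  have H1 : HasDerivAt (fun R => regWeight α (R, x.2) * (α ^ 2 * R ^ 2) * dz Φ R x.2)
      (((1 - 5 / α) / x.1 * regWeight α x * (α ^ 2 * x.1 ^ 2) + regWeight α (x.1, x.2) * (α ^ 2 * (2 * x.1))) * dz Φ x.1 x.2 +
        regWeight α (x.1, x.2) * (α ^ 2 * x.1 ^ 2) * dz (dz Φ) x.1 x.2) x.1 := (sw1.mul sR2).mul sdz
  have H2 : HasDerivAt (fun θ => regWeight α (x.1, θ) * dθ Φ x.1 θ)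
      (Real.tan x.2 * regWeight α x * dθ Φ x.1 x.2 + regWeight α (x.1, x.2) * dθ (dθ Φ) x.1 x.2) x.2 := sw2.mul sdθ
  have eD1 : dz (fun R θ => regWeight α (R, θ) * (α ^ 2 * R ^ 2) * dz Φ R θ) x.1 x.2 =
      ((1 - 5 / α) / x.1 * regWeight α x * (α ^ 2 * x.1 ^ 2) + regWeight α (x.1, x.2) * (α ^ 2 * (2 * x.1))) * dz Φ x.1 x.2 +
        regWeight α (x.1, x.2) * (α ^ 2 * x.1 ^ 2) * dz (dz Φ) x.1 x.2 := H1.deriv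
  have eD2 : dθ (fun R θ => regWeight α (R, θ) * dθ Φ R θ) x.1 x.2 =
      Real.tan x.2 * regWeight α x * dθ Φ x.1 x.2 + regWeight α (x.1, x.2) * dθ (dθ Φ) x.1 x.2 := H2.deriv
  have ex : (x.1, x.2) = x := rfl
  rw [ex] at eD1 eD2
  rw [show (fun R θ => regWeight α (R, θ) * (α ^ 2 * (R, θ).1 ^ 2) * dz Φ (R, θ).1 (R, θ).2) =
      fun R θ => regWeight α (R, θ) * (α ^ 2 * R ^ 2) * dz Φ R θ from rfl, eD1,
    show (fun R θ => regWeight α (R, θ) * dθ Φ (R, θ).1 (R, θ).2) = fun R θ => regWeight α (R, θ) * dθ Φ R θ from rfl, eD2]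
  rw [transposeOp_apply, divZero]
  have hR : x.1 ≠ 0 := hx.1.ne'
  field_simp
  ring

/-! ### Local smoothness of `U₀` -/

/-- Orthogonality to `K` passes from `f` to `toL2 f`. [folklore] -/
theorem orth_toL2 {f : ℝ × ℝ → ℝ} (hfc : Continuous f) (hfs : HasCompactSupport f)
    (HF : ∀ n : ℝ → ℝ, Continuous n → HasCompactSupport n → ∫ p in strip, f p * (n p.1 * kernelK p.2) = 0) :
    ∀ n : ℝ → ℝ, Continuous n → HasCompactSupport n → ∫ p in strip, (toL2 f : ℝ × ℝ → ℝ) p * (n p.1 * kernelK p.2) = 0 := by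
  intro n hn hns
  rw [← HF n hn hns]
  refine integral_congr_ae ?_
  filter_upwards [toL2_ae_eq' (memLp_strip_of_continuous hfc hfs)] with p hp
  rw [hp]

/-- `U₀/w` is locally integrable on the strip. [folklore] -/
theorem locallyIntegrableOn_div_regWeight (α : ℝ) (u : L2Strip) :
    LocallyIntegrableOn (fun x => (u : ℝ × ℝ → ℝ) x / regWeight α x) strip volume := by
  rw [locallyIntegrableOn_iff isOpen_strip.isLocallyClosed]
  intro k hk hkc
  have h1 : MemLp (u : ℝ × ℝ → ℝ) 2 (volume.restrict k) := by
    have h : MemLp (u : ℝ × ℝ → ℝ) 2 ((volume.restrict strip).restrict k) := (Lp.memLp u).restrict k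
    rw [Measure.restrict_restrict hkc.measurableSet, inter_eq_left.2 hk] at h
    exact h
  haveI : IsFiniteMeasure (volume.restrict k) := isFiniteMeasure_restrict.2 hkc.measure_lt_top.ne
  have h2 : IntegrableOn (u : ℝ × ℝ → ℝ) k volume := h1.integrable one_le_two
  have h3 : ContinuousOn (fun x => (regWeight α x)⁻¹) k :=
    ((contDiffOn_regWeight α (n := 0)).continuousOn.mono hk).inv₀ fun x hx => (regWeight_pos α (hk hx)).ne'
  have := h2.mul_continuousOn h3 hkc
  simpa [div_eq_mul_inv] using this

set_option maxHeartbeats 1600000 in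
/-- **The weak solution is a very weak solution of the divergence-form equation**: with
`v = U₀/w`, `∫ v·(∑ᵢⱼ ∂ⱼ(aᵢⱼ∂ᵢφ) − cφ) = ∫ (−f)·φ` for all smooth `φ` compactly supported in the
strip. [folklore] -/
theorem divForm_veryWeak {α : ℝ} (hα : 0 < α) {f : ℝ × ℝ → ℝ} (hfc : Continuous f) (hfs : HasCompactSupport f)
    (HF : ∀ n : ℝ → ℝ, Continuous n → HasCompactSupport n → ∫ p in strip, f p * (n p.1 * kernelK p.2) = 0)
    {U : E4} (hU : U ∈ weakSpace α) (hw : ∀ Ψ ∈ weakSpace α, energyForm α U Ψ = ⟪toL2 f, Ψ 0⟫_ℝ)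
    (φ : ℝ × ℝ → ℝ) (hφ : ContDiff ℝ ∞ φ) (hφs : HasCompactSupport φ) (hφS : tsupport φ ⊆ strip) :
    ∫ x, (fun x => (U 0 : ℝ × ℝ → ℝ) x / regWeight α x) x *
        ((∑ i, ∑ j, fderiv ℝ (fun y => divCoeff α i j y * fderiv ℝ φ y (stdBasis i)) x (stdBasis j)) - divZero α x * φ x) =
      ∫ x, (fun x => -f x) x * φ x := by
  show ∫ x, (U 0 : ℝ × ℝ → ℝ) x / regWeight α x * divBracket α φ x = ∫ x, -f x * φ x
  set Φ : ℝ → ℝ → ℝ := fun R θ => φ (R, θ) with hΦ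
  have euc : uncurry Φ = φ := by funext p; rfl
  have hΦn : ∀ n : ℕ, ContDiff ℝ n (uncurry Φ) := fun n => by rw [euc]; exact hφ.of_le (by exact_mod_cast (le_top : (n : ℕ∞) ≤ ⊤))
  have hΦs : HasCompactSupport (uncurry Φ) := by rw [euc]; exact hφs
  have hΦS : tsupport (uncurry Φ) ⊆ strip := by rw [euc]; exact hφS
  -- both sides live on the strip
  have l0 : ∀ x, x ∉ strip → (U 0 : ℝ × ℝ → ℝ) x / regWeight α x * divBracket α φ x = 0 := fun x hx => by
    rw [divBracket_eq_zero_of_notMem α (fun h => hx (hφS h)), mul_zero]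
  have r0 : ∀ x, x ∉ strip → -f x * φ x = 0 := fun x hx => by
    rw [show φ x = 0 from image_eq_zero_of_notMem_tsupport fun h => hx (hφS h), mul_zero]
  rw [← setIntegral_eq_integral_of_forall_compl_eq_zero (s := strip) (fun x hx => l0 x hx),
    ← setIntegral_eq_integral_of_forall_compl_eq_zero (s := strip) (fun x hx => r0 x hx)]
  -- on the strip: `v·(−w ᵗLΦ) = −U₀·ᵗLΦ`
  have e1 : ∫ x in strip, (U 0 : ℝ × ℝ → ℝ) x / regWeight α x * divBracket α φ x =
      -∫ x in strip, (U 0 : ℝ × ℝ → ℝ) x * transposeOp α Φ x := by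
    rw [← MeasureTheory.integral_neg]
    refine setIntegral_congr_fun measurableSet_strip fun x hx => ?_
    have hφ2 : ContDiff ℝ 2 φ := by simpa [euc] using hΦn 2
    rw [divBracket_eq_neg_weight_mul_transposeOp hα.ne' hφ2 hx]
    have hw0 : regWeight α x ≠ 0 := (regWeight_pos α hx).ne'
    field_simp
    rfl
  rw [e1, integral_weakSol_transposeOp (orth_toL2 hfc hfs HF) hU hw hΦn hΦs hΦS, ← MeasureTheory.integral_neg]
  refine integral_congr_ae ?_
  filter_upwards [toL2_ae_eq' (memLp_strip_of_continuous hfc hfs)] with p hp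
  rw [hp]; ring

/-- **Local smoothness of `U₀`** (Folland's Cor. (6.34) applied to `U₀/w`): every point of the strip
has a neighbourhood on which `U₀` agrees a.e. with a smooth function.
[cite: Elgindi2021, §7.1 Proposition 7.1 (p. 19 of arXiv:1904.04795), via Folland 1995 Cor. (6.34)] -/
theorem exists_local_smooth_rep {α : ℝ} (hα : 0 < α) {f : ℝ × ℝ → ℝ} (hfc : Continuous f) (hfs : HasCompactSupport f)
    (hf : ContDiffOn ℝ ∞ f strip)
    (HF : ∀ n : ℝ → ℝ, Continuous n → HasCompactSupport n → ∫ p in strip, f p * (n p.1 * kernelK p.2) = 0)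
    {U : E4} (hU : U ∈ weakSpace α) (hw : ∀ Ψ ∈ weakSpace α, energyForm α U Ψ = ⟪toL2 f, Ψ 0⟫_ℝ)
    {x₀ : ℝ × ℝ} (hx₀ : x₀ ∈ strip) :
    ∃ V : Set (ℝ × ℝ), IsOpen V ∧ x₀ ∈ V ∧ V ⊆ strip ∧
      ∃ g : ℝ × ℝ → ℝ, ContDiffOn ℝ ∞ g V ∧ ∀ᵐ x ∂(volume : Measure (ℝ × ℝ)), x ∈ V → (U 0 : ℝ × ℝ → ℝ) x = g x := by
  have hG : ContDiffOn ℝ ∞ (fun x => -f x) strip := hf.neg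
  obtain ⟨V, hV, hxV, hVS, g, hg, hae⟩ := exists_contDiffOn_ae_eq_of_divForm_weak (μ := (volume : Measure (ℝ × ℝ))) (b := stdBasis)
    Folland1995_cor634_holds isOpen_strip (a := divCoeff α) (contDiffOn_divCoeff α)
    (fun x hx v hv => divCoeff_pos hα.ne' hx v hv) (contDiffOn_divZero α) hG (locallyIntegrableOn_div_regWeight α (U 0))
    (divForm_veryWeak hα hfc hfs HF hU hw) hx₀
  refine ⟨V, hV, hxV, hVS, fun x => regWeight α x * g x, ((contDiffOn_regWeight α).mono hVS).mul hg, ?_⟩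
  filter_upwards [hae] with x hx hxV'
  have h := hx hxV'
  have hw0 : regWeight α x ≠ 0 := (regWeight_pos α (hVS hxV')).ne'
  field_simp at h
  linarith [h]

end Elgindi

end Literature.Analysis.FluidPDE
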